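import Mathlib
import Summits.Ventures.HodgeRepro.Tier4.Target
import Summits.Ventures.HodgeRepro.Tier4.Line3.DatumOrthVanishing

/-!
# Tier4/Line3/OrthPoint — the `J`-orthogonal point of a `J`-positive plane lies in the ball

Blind re-derivation cell `pub-hodge-repro`, Tier 4 «PROVE THE STEP», LINE L3, seat t4-x2 (g4, reserve wall-breaker),
cut C-L3-HKRAY: the point `z*` of every Laplace statement of the line (bus S14230 (4), S14325 (F7)/(F8)) as a kernel fact.

For `y_0, y_1 ∈ ℂ³` with independent first two coordinates (`hab`, the line's wedge clause) and spanning a `J`-positive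
plane (`hpos`, the line's positivity clause), the conj-affine system `(lift3 z)^* J y_j = 0` (`j = 0, 1`) has the unique
solution `z*` (Cramer), and `z* ∈ 𝔹`: with `w := lift3 z*` and `M := [y_0 | y_1 | w]`, the Gram matrix `Mᴴ J M` is block
diagonal `[[G, 0],[0, w^* J w]]`, so `det G · (w^* J w) = det (Mᴴ J M) = −|det M|²`; `det G > 0` (positivity of the
plane), `det M ≠ 0` (`w ∉ W`: a vector of `W` that is `J`-orthogonal to `W` is `0`, but `w_2 = 1`), hence
`w^* J w = |z*|² − 1 < 0`.  Corollary: the quadruple kernel of every `ThetaData` vanishes at `z*` (`kernel_eq_zero_of_jOrth`).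

Nothing here says anything about the status of the Hodge conjecture for CM abelian varieties, which is NOT proved
(HC_CM is NOT proved by anyone in this repository).
-/

set_option autoImplicit false

noncomputable section

namespace Summit.Ventures.HodgeRepro.Tier4.Line3

open Summit.Ventures.HodgeRepro.Tier4
open Matrix
open scoped ComplexConjugate

/-- `conj (u^* J v) = v^* J u`. -/
theorem conj_jform (u v : Fin 3 → ℂ) : conj (star u ⬝ᵥ (J *ᵥ v)) = star v ⬝ᵥ (J *ᵥ u) := by
  rw [jform_eq, jform_eq]
  simp only [map_add, map_sub, map_mul, Complex.conj_conj]
  ring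

/-- The form on a combination `a y_0 + b y_1`. -/
theorem jform_combination (y0 y1 : Fin 3 → ℂ) (a b : ℂ) :
    star (a • y0 + b • y1) ⬝ᵥ (J *ᵥ (a • y0 + b • y1)) =
      conj a * a * (star y0 ⬝ᵥ (J *ᵥ y0)) + conj a * b * (star y0 ⬝ᵥ (J *ᵥ y1)) +
        conj b * a * (star y1 ⬝ᵥ (J *ᵥ y0)) + conj b * b * (star y1 ⬝ᵥ (J *ᵥ y1)) := by
  simp only [star_add, star_smul, Matrix.mulVec_add, Matrix.mulVec_smul, add_dotProduct, dotProduct_add,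
    smul_dotProduct, dotProduct_smul, smul_eq_mul, Complex.star_def]
  ring

/-- The matrix with columns `y0, y1, w`. -/
def colMat (y0 y1 w : Fin 3 → ℂ) : Matrix (Fin 3) (Fin 3) ℂ := Matrix.of fun i j => (![y0, y1, w] j) i

/-- `colMat *ᵥ v = v₀ y0 + v₁ y1 + v₂ w`. -/
theorem colMat_mulVec (y0 y1 w : Fin 3 → ℂ) (v : Fin 3 → ℂ) :
    colMat y0 y1 w *ᵥ v = v 0 • y0 + v 1 • y1 + v 2 • w := by
  ext i
  simp [colMat, Matrix.mulVec, dotProduct, Fin.sum_univ_three, mul_comm]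

/-- The Gram matrix `Mᴴ J M` of the three columns. -/
theorem colMat_gram (y0 y1 w : Fin 3 → ℂ) :
    (colMat y0 y1 w)ᴴ * J * colMat y0 y1 w =
      Matrix.of fun i j => star (![y0, y1, w] i) ⬝ᵥ (J *ᵥ ![y0, y1, w] j) := by
  ext i j
  fin_cases i <;> fin_cases j <;>
    simp [colMat, Matrix.mul_apply, Fin.sum_univ_three, J, dotProduct, Matrix.mulVec, Matrix.conjTranspose_apply,
      Matrix.diagonal_apply]

/-- `det (Mᴴ J M) = −conj(det M) · det M`. -/
theorem det_colMat_gram (y0 y1 w : Fin 3 → ℂ) :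
    ((colMat y0 y1 w)ᴴ * J * colMat y0 y1 w).det = -(conj (colMat y0 y1 w).det * (colMat y0 y1 w).det) := by
  rw [Matrix.det_mul, Matrix.det_mul, Matrix.det_conjTranspose, J, Matrix.det_diagonal, Fin.prod_univ_three]
  simp

/-- **THE `J`-ORTHOGONAL POINT EXISTS IN THE BALL**: for `y_0, y_1` with independent first two coordinates spanning a
`J`-positive plane, there is `z* ∈ 𝔹` with `(lift3 z*)^* J y_0 = (lift3 z*)^* J y_1 = 0`. -/
theorem exists_jOrth_point {y0 y1 : Fin 3 → ℂ} (hab : y0 0 * y1 1 - y0 1 * y1 0 ≠ 0)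
    (hpos : ∀ u v : ℂ, (u ≠ 0 ∨ v ≠ 0) →
      0 < (star (u • y0 + v • y1) ⬝ᵥ (J *ᵥ (u • y0 + v • y1))).re) :
    ∃ z ∈ ball, star (lift3 z) ⬝ᵥ (J *ᵥ y0) = 0 ∧ star (lift3 z) ⬝ᵥ (J *ᵥ y1) = 0 := by
  -- Cramer's solution of `conj z₀ y_{j0} + conj z₁ y_{j1} = y_{j2}`
  set D : ℂ := y0 0 * y1 1 - y0 1 * y1 0 with hD
  set c0 : ℂ := (y0 2 * y1 1 - y0 1 * y1 2) / D with hc0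
  set c1 : ℂ := (y0 0 * y1 2 - y0 2 * y1 0) / D with hc1
  set z : Fin 2 → ℂ := ![conj c0, conj c1] with hz
  have hf0 : star (lift3 z) ⬝ᵥ (J *ᵥ y0) = 0 := by
    rw [jform_eq]
    simp only [hz, lift3, Matrix.cons_val_zero, Matrix.cons_val_one, Matrix.head_cons, Matrix.cons_val_two,
      Matrix.tail_cons, Complex.conj_conj, map_one, one_mul, hc0, hc1]
    field_simp
    ring
  have hf1 : star (lift3 z) ⬝ᵥ (J *ᵥ y1) = 0 := by
    rw [jform_eq]
    simp only [hz, lift3, Matrix.cons_val_zero, Matrix.cons_val_one, Matrix.head_cons, Matrix.cons_val_two,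
      Matrix.tail_cons, Complex.conj_conj, map_one, one_mul, hc0, hc1]
    field_simp
    ring
  refine ⟨z, ?_, hf0, hf1⟩
  -- the determinant argument
  set w : Fin 3 → ℂ := lift3 z with hw
  have hw2 : w 2 = 1 := rfl
  have hy0w : star y0 ⬝ᵥ (J *ᵥ w) = 0 := by rw [← conj_jform, hf0, map_zero]
  have hy1w : star y1 ⬝ᵥ (J *ᵥ w) = 0 := by rw [← conj_jform, hf1, map_zero]
  set q : ℂ := star w ⬝ᵥ (J *ᵥ w) with hq
  set G00 : ℂ := star y0 ⬝ᵥ (J *ᵥ y0) with hG00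
  set G01 : ℂ := star y0 ⬝ᵥ (J *ᵥ y1) with hG01
  set G10 : ℂ := star y1 ⬝ᵥ (J *ᵥ y0) with hG10
  set G11 : ℂ := star y1 ⬝ᵥ (J *ᵥ y1) with hG11
  -- the Gram determinant in block form
  have hgram : ((colMat y0 y1 w)ᴴ * J * colMat y0 y1 w).det = (G00 * G11 - G01 * G10) * q := by
    rw [colMat_gram, Matrix.det_fin_three]
    simp only [Matrix.of_apply, Matrix.cons_val_zero, Matrix.cons_val_one, Matrix.head_cons, Matrix.cons_val_two,
      Matrix.tail_cons, hf0, hf1, hy0w, hy1w, ← hG00, ← hG01, ← hG10, ← hG11, ← hq]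
    ring
  -- `det M ≠ 0`: the columns are independent
  have hdet : (colMat y0 y1 w).det ≠ 0 := by
    intro h0
    obtain ⟨v, hv, hMv⟩ := (Matrix.exists_mulVec_eq_zero_iff).2 h0
    rw [colMat_mulVec] at hMv
    by_cases hv2 : v 2 = 0
    · have hv01 : v 0 ≠ 0 ∨ v 1 ≠ 0 := by
        by_contra hcon
        push Not at hcon
        apply hv
        ext i
        fin_cases i
        · exact hcon.1
        · exact hcon.2
        · exact hv2
      have h := hpos (v 0) (v 1) hv01
      rw [hv2, zero_smul, add_zero] at hMv
      rw [hMv] at h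
      simp at h
    · -- `w ∈ W`: `w = a y0 + b y1` with `(a, b) ≠ 0`
      have hwab : w = (-(v 0) / v 2) • y0 + (-(v 1) / v 2) • y1 := by
        have : v 2 • w = -(v 0 • y0 + v 1 • y1) := by
          rw [eq_neg_iff_add_eq_zero, add_comm]
          exact hMv
        ext i
        have hi := congrFun this i
        simp only [Pi.smul_apply, smul_eq_mul, Pi.neg_apply, Pi.add_apply] at hi ⊢
        rw [div_mul_eq_mul_div, div_mul_eq_mul_div, ← add_div, eq_div_iff hv2]
        linear_combination hi
      have hab' : -(v 0) / v 2 ≠ 0 ∨ -(v 1) / v 2 ≠ 0 := by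
        by_contra hcon
        push Not at hcon
        have h2 := congrFun hwab 2
        rw [hcon.1, hcon.2] at h2
        simp [hw2] at h2
      have hpos' := hpos _ _ hab'
      rw [← hwab] at hpos'
      have hq0 : star w ⬝ᵥ (J *ᵥ w) = 0 := by
        have hJw : J *ᵥ w = J *ᵥ ((-(v 0) / v 2) • y0 + (-(v 1) / v 2) • y1) := by rw [← hwab]
        rw [hJw, Matrix.mulVec_add, Matrix.mulVec_smul, Matrix.mulVec_smul, dotProduct_add, dotProduct_smul,
          dotProduct_smul, hf0, hf1]
        simp
      rw [hq0] at hpos'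
      simp at hpos'
  -- `det G > 0` and `G00, G11` real
  have hG10c : G10 = conj G01 := by rw [hG10, hG01, conj_jform]
  have hG00r : conj G00 = G00 := conj_jform_self y0
  have hG11r : conj G11 = G11 := conj_jform_self y1
  have hG00pos : 0 < G00.re := by
    have h := hpos 1 0 (Or.inl one_ne_zero)
    simpa using h
  have hG11pos : 0 < G11.re := by
    have h := hpos 0 1 (Or.inr one_ne_zero)
    simpa using h
  have hdG : 0 < (G00 * G11 - G01 * G10).re := by
    -- the combination `a = G11, b = −conj G01`
    have hG11ne : G11 ≠ 0 := fun h => by rw [h] at hG11pos; simp at hG11pos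
    have h := hpos G11 (-(conj G01)) (Or.inl hG11ne)
    rw [jform_combination, ← hG00, ← hG01, ← hG10, ← hG11, hG10c, map_neg, Complex.conj_conj, hG11r] at h
    have hid : conj G11 * G11 * G00 + conj G11 * -(conj G01) * G01 + -G01 * G11 * conj G01 +
        -G01 * -(conj G01) * G11 = G11 * (G00 * G11 - G01 * conj G01) := by
      rw [hG11r]
      ring
    rw [hG11r] at hid
    rw [hid, ← hG10c] at h
    -- `G11` is a positive real: `(G11 * X).re = G11.re * X.re` since `G11.im = 0`
    have hG11im : G11.im = 0 := by
      have := congrArg Complex.im hG11r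
      simp only [Complex.conj_im] at this
      linarith
    rw [Complex.mul_re, hG11im, zero_mul, sub_zero] at h
    exact pos_of_mul_pos_right h hG11pos.le
  -- conclude
  have hkey : (G00 * G11 - G01 * G10) * q = -(conj (colMat y0 y1 w).det * (colMat y0 y1 w).det) := by
    rw [← hgram, det_colMat_gram]
  have hqreal : q = ((nsq z - 1 : ℝ) : ℂ) := by rw [hq, hw, jform_lift3_self]
  have hdGreal : (G00 * G11 - G01 * G10).im = 0 := by
    rw [hG10c]
    have h1 : G00.im = 0 := by
      have := congrArg Complex.im hG00r
      simp only [Complex.conj_im] at this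
      linarith
    have h2 : G11.im = 0 := by
      have := congrArg Complex.im hG11r
      simp only [Complex.conj_im] at this
      linarith
    simp [Complex.sub_im, Complex.mul_im, h1, h2, Complex.conj_re, Complex.conj_im]
    ring
  have hre := congrArg Complex.re hkey
  rw [hqreal, Complex.mul_re, hdGreal, Complex.ofReal_re, Complex.ofReal_im, zero_mul, sub_zero,
    Complex.neg_re, Complex.conj_mul', ← Complex.ofReal_pow, Complex.ofReal_re] at hre
  have hnorm : 0 < ‖(colMat y0 y1 w).det‖ ^ 2 := by positivity
  show nsq z < 1
  by_contra hcon
  push Not at hcon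
  have : 0 ≤ (G00 * G11 - G01 * G10).re * (nsq z - 1) := mul_nonneg hdG.le (by linarith)
  linarith

end Summit.Ventures.HodgeRepro.Tier4.Line3

end
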